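import Literature.Analysis.FluidPDE.TypeIAncientMild
import Literature.Analysis.FluidPDE.KNSSTypeIRateLiouvilleHolds
import Summits.NavierStokesRegularity.NavierStokesRegularity.Theorems.SqueezeCycleExtremalElementExistsRescale
import Mathlib.Analysis.InnerProductSpace.Projection.Reflection

/-!
# Candidate proof (disprover's evidence, NOT a landing) of `stub_periodicBlowdownVanishing`
# (the LEVER) — line `blowdown-kills-pitch`, crux `SymmetricLiouville` (stmt-NavierStokesRegularity-4053)

`Sig.stub_periodicBlowdownVanishing` / `stub_periodicBlowdownVanishing` of the lead's skeleton
(`Cruxes/SymmetricLiouville/Lines/blowdown-kills-pitch.lean`, skeleton `415f7ae75d4c`), verbatim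
signature, proved sorry-free from tree theorems: the zoom covariance
`Theorems.isTypeIAncientMild_zoom` (+ `zoom_apply`), the KNSS 2.5-D Liouville theorem
`KNSS2009_typeI_rate_liouville_holds` (`KNSSTypeIRateLiouvilleHolds`), Mathlib's
`Submodule.reflection_sub` (a linear isometry taking `e/|e|` to `e₂`) and
`TendstoLocallyUniformly.tendsto_comp`; the F3 compactness and the rotation covariance enter as
the stub's own antecedents. Argument: violators `(t_n → −∞, x_n)` of `√(−t)‖u‖ ≤ ε` ⇒ blow-downs
`c_n u(c_n² s, x_n + c_n y)`, `c_n = √(−t_n) → ∞`, in `A_C`, with `‖·(−1, 0)‖ > ε` and period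
`e/c_n → 0`; the F3-limit `W` has `‖W(−1,0)‖ ≥ ε` and is invariant under the whole line `ℝe`
(`⌊s c_n⌋/c_n → s`); rotating `e/|e| ↦ e₂` and shifting time by `½` produces a BOUNDED
`x₂`-independent ancient Oseen-mild field with `√(−t)|W| ≤ C`, which the KNSS theorem kills —
contradiction. Written by the standing disprover (refuter-cdisprove-…-4053-g3); same namespace as
the skeleton, so the lead may paste it.
-/

noncomputable section

open Set Function Filter Topology
open Literature.Analysis Literature.Analysis.FluidPDE
open Summit.NavierStokesRegularity.NavierStokesRegularity.Theorems (isTypeIAncientMild_zoom zoom_apply)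

namespace Summit.NavierStokesRegularity.NavierStokesRegularity.Theorems.SymmetryModuliCountSymmetricLiouville

/-- Local notation for physical space `ℝ³`. -/
local notation "E3" => EuclideanSpace ℝ (Fin 3)

/-- A field with period `e` has every natural multiple of `e` as a period. -/
theorem periodic_nat {f : E3 → E3} {e : E3} (h : ∀ x, f (x + e) = f x) :
    ∀ (n : ℕ) (x : E3), f (x + (n : ℝ) • e) = f x
  | 0, x => by simp
  | n + 1, x => by
    have e1 : x + ((n : ℝ) + 1) • e = (x + (n : ℝ) • e) + e := by rw [add_smul, one_smul, add_assoc]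
    rw [Nat.cast_succ, e1, h, periodic_nat h n x]

/-- **Stub 3 of the skeleton (the lever), verbatim signature**: blow-down kills the pitch. -/
theorem stub_periodicBlowdownVanishing_proof :
    ∀ C : ℝ,
      (∀ v : ℕ → ℝ → E3 → E3, (∀ n, IsTypeIAncientMild C (v n)) →
      ∃ (φ : ℕ → ℕ) (w : ℝ → E3 → E3), StrictMono φ ∧ IsTypeIAncientMild C w ∧
        ∀ t < 0, TendstoLocallyUniformly (fun n => v (φ n) t) (w t) atTop) →
      (∀ (L : E3 ≃ₗᵢ[ℝ] E3) (u : ℝ → E3 → E3), IsTypeIAncientMild C u →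
      IsTypeIAncientMild C (fun t x => L (u t (L.symm x)))) →
      ∀ u : ℝ → E3 → E3, IsTypeIAncientMild C u →
        ∀ e : E3, e ≠ 0 → (∀ t < 0, ∀ x, u t (x + e) = u t x) →
        ∀ ε > 0, ∃ T < 0, ∀ t < T, ∀ x, Real.sqrt (-t) * ‖u t x‖ ≤ ε := by
  intro C hF3 hrot u hu e he hper ε hε
  by_contra hcon
  push Not at hcon
  -- violating sequence `t_n < -(n+1)`, `x_n`
  have hseq : ∀ n : ℕ, ∃ t : ℝ, t < -((n : ℝ) + 1) ∧ ∃ x : E3, ε < Real.sqrt (-t) * ‖u t x‖ :=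
    fun n => hcon (-((n : ℝ) + 1)) (by have := n.cast_nonneg (α := ℝ); linarith)
  choose tn htn xn hxn using hseq
  have htn0 : ∀ n, tn n < 0 := fun n => by
    have h1 := htn n
    have h2 := n.cast_nonneg (α := ℝ)
    linarith
  -- scales `c_n = √(−t_n) → ∞`
  obtain ⟨c, hc⟩ : ∃ c : ℕ → ℝ, ∀ n, c n = Real.sqrt (-tn n) := ⟨_, fun n => rfl⟩
  have hcpos : ∀ n, 0 < c n := fun n => by rw [hc]; exact Real.sqrt_pos.2 (by linarith [htn0 n])
  have hcsq : ∀ n, c n ^ 2 = -tn n := fun n => by rw [hc]; exact Real.sq_sqrt (by linarith [htn0 n])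
  have hc_tendsto : Tendsto c atTop atTop := by
    refine tendsto_atTop.2 fun b => ?_
    refine (eventually_ge_atTop (⌈b ^ 2⌉₊)).mono fun n hn => ?_
    have hn' : b ^ 2 ≤ (n : ℝ) := (Nat.le_ceil _).trans (by exact_mod_cast hn)
    have h1 : b ^ 2 ≤ -tn n := by have := htn n; linarith
    calc b ≤ |b| := le_abs_self b
      _ = Real.sqrt (b ^ 2) := (Real.sqrt_sq_eq_abs b).symm
      _ ≤ Real.sqrt (-tn n) := Real.sqrt_le_sqrt h1
      _ = c n := (hc n).symm
  -- blow-downs `v_n (s, y) = c_n u(c_n² s, x_n + c_n y)` in `A_C`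
  obtain ⟨v, hv⟩ : ∃ v : ℕ → ℝ → E3 → E3, ∀ n, v n = c n • stPull (c n ^ 2) (c n) 0 (xn n) u :=
    ⟨_, fun n => rfl⟩
  have hvcl : ∀ n, IsTypeIAncientMild C (v n) := fun n => by
    rw [hv]; exact isTypeIAncientMild_zoom hu (hcpos n) (xn n)
  have hv_apply : ∀ n s y, v n s y = c n • u (c n ^ 2 * s) (xn n + c n • y) := fun n s y => by
    rw [hv n]; exact zoom_apply _ _ _ _ _
  have hv0 : ∀ n, ε < ‖v n (-1) 0‖ := by
    intro n
    have e1 : c n ^ 2 * -1 = tn n := by rw [hcsq]; ring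
    rw [hv_apply, smul_zero, add_zero, e1, norm_smul, Real.norm_of_nonneg (hcpos n).le, hc]
    exact hxn n
  -- natural multiples of `e/c_n` are periods of `v_n`
  have hvper : ∀ n, ∀ s < 0, ∀ (k : ℕ) (y : E3), v n s (y + ((k : ℝ) * (c n)⁻¹) • e) = v n s y := by
    intro n s hs k y
    have hcs : c n ^ 2 * s < 0 := mul_neg_of_pos_of_neg (pow_pos (hcpos n) 2) hs
    have e1 : c n * ((k : ℝ) * (c n)⁻¹) = k := by
      rw [mul_comm, mul_assoc, inv_mul_cancel₀ (hcpos n).ne', mul_one]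
    rw [hv_apply, hv_apply, smul_add, smul_smul, e1, ← add_assoc]
    congr 1
    exact periodic_nat (hper _ hcs) k _
  -- F3: extract a limit `W ∈ A_C`
  obtain ⟨φ, W, hφ, hW, hloc⟩ := hF3 v hvcl
  have hW0 : ε ≤ ‖W (-1) 0‖ := by
    have h1 : Tendsto (fun j => v (φ j) (-1) 0) atTop (𝓝 (W (-1) 0)) :=
      (hloc (-1) (by norm_num)).tendsto_comp (hW.continuous_slice (by norm_num)).continuousAt
        tendsto_const_nhds
    exact ge_of_tendsto' h1.norm fun j => (hv0 (φ j)).le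
  -- the limit is invariant under the whole line `ℝ e`
  have hcφ : Tendsto (fun j => c (φ j)) atTop atTop := hc_tendsto.comp hφ.tendsto_atTop
  have hline_pos : ∀ t < 0, ∀ (y : E3) (s : ℝ), 0 ≤ s → W t (y + s • e) = W t y := by
    intro t ht y s hs
    have hg : Tendsto (fun j => (⌊s * c (φ j)⌋₊ : ℝ) * (c (φ j))⁻¹) atTop (𝓝 s) := by
      have hinv : Tendsto (fun j => (c (φ j))⁻¹) atTop (𝓝 0) := tendsto_inv_atTop_zero.comp hcφ
      have hlow : Tendsto (fun j => s - (c (φ j))⁻¹) atTop (𝓝 s) := by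
        simpa using tendsto_const_nhds.sub hinv
      refine tendsto_of_tendsto_of_tendsto_of_le_of_le hlow tendsto_const_nhds (fun j => ?_)
        (fun j => ?_)
      · have hcj := hcpos (φ j)
        have h1 : s * c (φ j) < (⌊s * c (φ j)⌋₊ : ℝ) + 1 := Nat.lt_floor_add_one _
        have h2 : s - (c (φ j))⁻¹ = (s * c (φ j) - 1) * (c (φ j))⁻¹ := by field_simp
        show s - (c (φ j))⁻¹ ≤ (⌊s * c (φ j)⌋₊ : ℝ) * (c (φ j))⁻¹
        rw [h2]
        exact mul_le_mul_of_nonneg_right (by linarith) (inv_nonneg.2 hcj.le)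
      · have hcj := hcpos (φ j)
        have h1 : (⌊s * c (φ j)⌋₊ : ℝ) ≤ s * c (φ j) := Nat.floor_le (by positivity)
        show (⌊s * c (φ j)⌋₊ : ℝ) * (c (φ j))⁻¹ ≤ s
        calc (⌊s * c (φ j)⌋₊ : ℝ) * (c (φ j))⁻¹ ≤ (s * c (φ j)) * (c (φ j))⁻¹ :=
              mul_le_mul_of_nonneg_right h1 (inv_nonneg.2 hcj.le)
          _ = s := by field_simp
    have hgE : Tendsto (fun j => y + ((⌊s * c (φ j)⌋₊ : ℝ) * (c (φ j))⁻¹) • e) atTop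
        (𝓝 (y + s • e)) :=
      tendsto_const_nhds.add (hg.smul_const e)
    have h1 : Tendsto (fun j => v (φ j) t (y + ((⌊s * c (φ j)⌋₊ : ℝ) * (c (φ j))⁻¹) • e)) atTop
        (𝓝 (W t (y + s • e))) :=
      (hloc t ht).tendsto_comp (hW.continuous_slice ht).continuousAt hgE
    have h2 : Tendsto (fun j => v (φ j) t y) atTop (𝓝 (W t y)) :=
      (hloc t ht).tendsto_comp (hW.continuous_slice ht).continuousAt tendsto_const_nhds
    have h3 : (fun j => v (φ j) t (y + ((⌊s * c (φ j)⌋₊ : ℝ) * (c (φ j))⁻¹) • e)) =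
        fun j => v (φ j) t y := by
      funext j
      exact hvper (φ j) t ht _ y
    rw [h3] at h1
    exact tendsto_nhds_unique h1 h2
  have hline : ∀ t < 0, ∀ (y : E3) (s : ℝ), W t (y + s • e) = W t y := by
    intro t ht y s
    rcases le_or_gt 0 s with hs | hs
    · exact hline_pos t ht y s hs
    · have h1 := hline_pos t ht (y + s • e) (-s) (by linarith)
      rw [add_assoc, ← add_smul, add_neg_cancel, zero_smul, add_zero] at h1
      exact h1.symm
  -- rotate `e/|e|` onto the `x₂`-axis and shift time by `1/2`
  obtain ⟨e1, he1⟩ : ∃ e1 : E3, e1 = ‖e‖⁻¹ • e := ⟨_, rfl⟩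
  obtain ⟨f2, hf2⟩ : ∃ f2 : E3, f2 = EuclideanSpace.single 1 (1 : ℝ) := ⟨_, rfl⟩
  have hne1 : ‖e1‖ = ‖f2‖ := by
    rw [he1, hf2, norm_smul, norm_inv, norm_norm, inv_mul_cancel₀ (norm_ne_zero_iff.2 he)]
    simp
  obtain ⟨L, hL⟩ : ∃ L : E3 ≃ₗᵢ[ℝ] E3, L = (ℝ ∙ (e1 - f2))ᗮ.reflection := ⟨_, rfl⟩
  have hLe1 : L e1 = f2 := by rw [hL]; exact Submodule.reflection_sub hne1
  have hLsymm : L.symm f2 = e1 := by rw [← hLe1, LinearIsometryEquiv.symm_apply_apply]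
  obtain ⟨W1, hW1def⟩ : ∃ W1 : ℝ → E3 → E3, W1 = fun t x => L (W t (L.symm x)) := ⟨_, rfl⟩
  have hW1 : IsTypeIAncientMild C W1 := by rw [hW1def]; exact hrot L W hW
  obtain ⟨W2, hW2def⟩ : ∃ W2 : ℝ → E3 → E3, W2 = fun t => W1 (t - 1 / 2) := ⟨_, rfl⟩
  have hW2 : IsTypeIAncientMild C W2 := by rw [hW2def]; exact hW1.comp_sub_right (by norm_num)
  have hW2_apply : ∀ t x, W2 t x = L (W (t - 1 / 2) (L.symm x)) := fun t x => by
    rw [hW2def, hW1def]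
  have hW2_norm : ∀ t < 0, ∀ x, ‖W2 t x‖ ≤ C / Real.sqrt (-(t - 1 / 2)) := fun t ht x => by
    rw [hW2def]
    exact hW1.norm_le (by linarith) x
  -- the hypotheses of the KNSS 2.5-D Liouville theorem
  have hK1 : ContinuousOn (uncurry W2) (Iio 0 ×ˢ univ) := hW2.continuousOn_uncurry
  have hK2 : ∃ K : ℝ, ∀ t < 0, ∀ x, ‖W2 t x‖ ≤ K := by
    refine ⟨C / Real.sqrt (1 / 2), fun t ht x => (hW2_norm t ht x).trans ?_⟩
    exact div_le_div_of_nonneg_left hW2.nonneg (Real.sqrt_pos.2 (by norm_num))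
      (Real.sqrt_le_sqrt (by linarith))
  have hK3 : ∀ t < 0, IsWeaklyDivFree (W2 t) := fun t ht => hW2.isWeaklyDivFree ht
  have hK4 : ∀ s t : ℝ, s < t → t < 0 → ∀ x, W2 t x =
      UnboundedOperators.heatExtension (W2 s) (t - s) x - oseenDuhamel 1 s W2 W2 t x :=
    fun s t hst ht x => hW2.mild_eq_heatExtension hst ht x
  have hK5 : ∀ t < 0, ∀ (x : E3) (δ : ℝ), W2 t (x + EuclideanSpace.single 1 δ) = W2 t x := by
    intro t ht x δ
    have e2 : EuclideanSpace.single (1 : Fin 3) δ = δ • f2 := by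
      rw [hf2]
      ext i
      fin_cases i <;> simp
    rw [hW2_apply, hW2_apply, map_add, e2, LinearIsometryEquiv.map_smul, hLsymm, he1, smul_smul]
    congr 1
    exact hline (t - 1 / 2) (by linarith) (L.symm x) _
  have hK6 : ∀ t < 0, ∀ x, Real.sqrt (-t) * ‖W2 t x‖ ≤ C := by
    intro t ht x
    have h1 := hW2_norm t ht x
    have hs : Real.sqrt (-t) ≤ Real.sqrt (-(t - 1 / 2)) := Real.sqrt_le_sqrt (by linarith)
    have hpos : 0 < Real.sqrt (-(t - 1 / 2)) := Real.sqrt_pos.2 (by linarith)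
    calc Real.sqrt (-t) * ‖W2 t x‖ ≤ Real.sqrt (-(t - 1 / 2)) * (C / Real.sqrt (-(t - 1 / 2))) :=
          mul_le_mul hs h1 (norm_nonneg _) (Real.sqrt_nonneg _)
      _ = C := by rw [← mul_div_assoc, mul_div_cancel_left₀ _ hpos.ne']
  have hzero : ∀ t < 0, ∀ x, W2 t x = 0 := KNSS2009_typeI_rate_liouville_holds hK1 hK2 hK3 hK4 hK5 hK6
  -- conclude: `W(−1, 0) = 0`, contradicting `‖W(−1, 0)‖ ≥ ε`
  have h1 : W2 (-1 / 2) 0 = 0 := hzero (-1 / 2) (by norm_num) 0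
  rw [hW2_apply, map_zero, show (-1 / 2 - 1 / 2 : ℝ) = -1 by norm_num] at h1
  have h3 : W (-1) 0 = 0 := by simpa using h1
  rw [h3, norm_zero] at hW0
  linarith

end Summit.NavierStokesRegularity.NavierStokesRegularity.Theorems.SymmetryModuliCountSymmetricLiouville

end
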